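import Mathlib

/-!
# Route BarrierLever — item 22038 `ChowBenchmarkPairs`, line `moore-peel`: the LEADING-TERM LEMMA for
# one-parameter degenerations (toolkit for the contraction chain of MEMO-freenode-g15 §10)

Helper file (`--supports stmt-ValiantsHypothesis-22038`; cell valiant-natproofs, rung V4, 𝒟-side
benchmark of record; seat valiant-natproofs-prover gen 15).  Closes NO item; definition-free; pure
linear algebra over `ℂ[X]`.

Every step of the cluster peel (the first-order reduction `…ChowBenchmarkPairsFirstOrder` is the first
instance) has the same shape: a square matrix `N(X)` over `ℂ[X]` (the segment-moment matrix of a table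
depending polynomially on a contraction parameter `X`), a row operation `L` with unit determinant after
which row `i` is divisible by `X^{m i}`, and the matrix `M̃` of quotients whose value at `X = 0` — the
LEADING MATRIX — is known.  The lemma packages the conclusion once and for all:

* `det_eq_X_pow_mul_of_rows` — if `L * N = [X^{m i} · M̃ i j]` then `det L · det N = X^{Σ m} · det M̃`;
* **`exists_eval_det_ne_zero_of_leading`** — if moreover `det L` is a unit and the leading matrix
  `M̃(0)` is nonsingular, then `det N(ε) ≠ 0` for some complex `ε ≠ 0` (indeed for all but finitely
  many `ε`).

WHAT THIS IS NOT: bookkeeping only; nothing on items 20172 / 19717, crux stmt-ValiantsHypothesis-14610,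
or `VP` versus `VNP`.
-/

set_option linter.dupNamespace false

namespace Summit.ValiantsHypothesis.ValiantsHypothesis.Theorems.BarrierLever.ChowBenchmarkLeadingTerm

open Polynomial

variable {n : Type*} [Fintype n] [DecidableEq n]

/-- If a row operation `L` makes every row `i` of `N` divisible by `X^{m i}` with quotient matrix `M̃`,
then `det L · det N = X^{Σ_i m i} · det M̃`. -/
theorem det_eq_X_pow_mul_of_rows (N L Mt : Matrix n n ℂ[X]) (m : n → ℕ)
    (hLN : L * N = Matrix.of fun i j => (X : ℂ[X]) ^ m i * Mt i j) :
    L.det * N.det = (X : ℂ[X]) ^ (∑ i, m i) * Mt.det := by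
  rw [← Matrix.det_mul, hLN, Matrix.det_mul_column, Finset.prod_pow_eq_pow_sum]

/-- **Leading-term lemma.**  Let `N, L, M̃` be square matrices over `ℂ[X]` with `L * N = [X^{m i}·M̃ i j]`,
`det L` a unit, and the leading matrix `M̃(0)` nonsingular.  Then `det N(ε) ≠ 0` for some `ε ≠ 0`. -/
theorem exists_eval_det_ne_zero_of_leading (N L Mt : Matrix n n ℂ[X]) (m : n → ℕ)
    (hLN : L * N = Matrix.of fun i j => (X : ℂ[X]) ^ m i * Mt i j) (hL : IsUnit L.det)
    (h0 : ((Polynomial.evalRingHom (0 : ℂ)).mapMatrix Mt).det ≠ 0) :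
    ∃ ε : ℂ, ε ≠ 0 ∧ ((Polynomial.evalRingHom ε).mapMatrix N).det ≠ 0 := by
  classical
  have hprod := det_eq_X_pow_mul_of_rows N L Mt m hLN
  -- `det M̃ ≠ 0` since its value at `0` is nonzero
  have hMt : Mt.det ≠ 0 := by
    intro e
    apply h0
    rw [← RingHom.map_det, e, map_zero]
  -- `det L` is a nonzero constant
  obtain ⟨c, hc, hcL⟩ := Polynomial.isUnit_iff.mp hL
  have hc0 : c ≠ 0 := hc.ne_zero
  -- a nonzero non-root of `X · det M̃`
  have hXM : (X : ℂ[X]) * Mt.det ≠ 0 := mul_ne_zero Polynomial.X_ne_zero hMt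
  obtain ⟨ε, hε⟩ := Infinite.exists_notMem_finset (((X : ℂ[X]) * Mt.det).roots.toFinset)
  rw [Multiset.mem_toFinset, Polynomial.mem_roots hXM, Polynomial.IsRoot.def, Polynomial.eval_mul,
    Polynomial.eval_X, mul_eq_zero, not_or] at hε
  obtain ⟨hε0, hεM⟩ := hε
  refine ⟨ε, hε0, fun hN => ?_⟩
  -- evaluate `det L · det N = X^{Σm} · det M̃` at `ε`
  have e := congrArg (Polynomial.eval ε) hprod
  rw [Polynomial.eval_mul, Polynomial.eval_mul, Polynomial.eval_pow, Polynomial.eval_X, ← hcL,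
    Polynomial.eval_C, ← Polynomial.coe_evalRingHom, RingHom.map_det, hN, mul_zero] at e
  exact mul_ne_zero (pow_ne_zero _ hε0) (by rwa [Polynomial.coe_evalRingHom] ) e.symm

end Summit.ValiantsHypothesis.ValiantsHypothesis.Theorems.BarrierLever.ChowBenchmarkLeadingTerm
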